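import Summits.HodgeConjecture.HodgeConjecture.Theorems.F0P3cStCharTSTorusDefs          -- ★ p849564 (LH6-p01 (g2)): `hyperbolicSet`, `torusChart`, `torusChartEntries`; brings ★ p849333 `M_c` lemmas
import Summits.HodgeConjecture.HodgeConjecture.Theorems.F0P3cStCharTSTorusRay           -- ★ p849400 (LH6-p05 (g2)): `coe_apply_ne_zero`
import HarnessLib

/-!
# F0 · P3c · line LH6 «StCharTS» — «HYP-SET★» (H1)+(H2): THE HYPERBOLIC SET `Ω` OF (TOR) IS CONJUGATION-INVARIANT AND REGULAR; ITS TRACE-OPEN CORE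
# `Ω° = {γ ∈ U(Φ₃)(L⁺_v) : |tr γ|_w > 1}` IS OPEN, CONJUGATION-INVARIANT, AND CONTAINS THE CHART IMAGE OF EVERY NON-UNIT SHELL `m₀ • M_c`
# [Rogawski1990 §12.5 p. 182 (`G^r ∩ Ad(G)M`); §12.7 L. 12.7.1 (proof) p. 191, L. 12.7.2 (proof) p. 193]

Cell `pub/hodgecm-mathlib`, crux H413 = `stmt-HodgeConjecture-24833` (`--supports` lane, helper), route HCCMUnconditional; seat F0P3a-p05 (g19), deal «HYP-SET★» of
«LH6» F0P3b-plan (g23) 05:47:17Z ((TOR)-road brick; integrator LH6-p01 (g2)).  THEOREMS ONLY (no definition, no instance, no notation, no named fact, no `sorry`);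
★-only imports.  The set `Ω° := {γ | 1 < |(tr γ)_w|}` is written INLINE (set-builder) in every statement, with the component spelled `Pi.evalRingHom _ w` as road (D) does.

* §1 (H1) `conj_mem_hyperbolicSet`, `isRegularElt_of_mem_hyperbolicSet`, `hyperbolicSet_subset_setOf_isRegularElt` — `hyperbolicSet L v` (★ `F0P3cStCharTSTorusDefs`: the
  conjugates of the regular elements of the diagonal torus `T`) is stable under `g ↦ h g h⁻¹` (`IsConj.trans`) and consists of regular elements (★ `isRegularElt_of_isConj`).
* §2 (H2) the TRACE-OPEN CORE: `isOpen_setOf_one_lt_v_trace` (continuity of `γ ↦ (tr γ)_w`, the closed unit ball of `L_w` is closed), `trace_conj` ∕ `conj_mem_setOf_one_lt_v_trace_iff`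
  (`tr (hγh⁻¹) = tr γ`), `v_trace_torusChart` ∕ **`torusChart_mem_setOf_one_lt_v_trace_iff`**: for `t = ι(α, z) = d(α, zσ(α)α⁻¹, σ(α)⁻¹)` at a NON-SPLIT `v` the three diagonal
  entries have `w`-valuations `|α|, 1, |α|⁻¹`, so (ultrametric) `|tr t|_w > 1 ⟺ |α_w| ≠ 1`; hence **`torusChart_mem_setOf_one_lt_v_trace_of_mem_smul_torusCompactPart`**: every
  point of a NON-UNIT SHELL `m₀ • M_c` (`m₀ ∉ M_c = 𝒪_vˣ × E¹_v`, ★ p849333) charts into `Ω°`, and so does every conjugate (`conj_torusChart_mem_setOf_one_lt_v_trace_of_mem_smul`) —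
  the support region of the (SHF′) test functions.
(H3) «`Ω° ⊆ hyperbolicSet`» (Newton slopes `−r, 0, r` of the unitary characteristic polynomial, Hensel in `L_w`, isotropic eigenline ⇒ conjugate into `T`) is the next file.
HONEST LABEL: count-neutral (TOR)-road brick; HC_CM is proved only modulo the 7 printed citations (2 remaining: hLiu418 = stmt-HodgeConjecture-24832, h413 =
stmt-HodgeConjecture-24833) until rung 0 closes.

## References
* [Rogawski1990] J. D. Rogawski, *Automorphic Representations of Unitary Groups in Three Variables*, Ann. of Math. Stud. 123 (1990): §3.1 p. 19 (regular elements); §12.2 p. 173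
  (`M ≅ E* × E¹`); §12.5 p. 182 (`G^r`, the elliptic∕hyperbolic dichotomy); §12.7 L. 12.7.1 (proof) p. 191 (test functions with `F_f` supported on `η^m𝒪* ∪ η^{−m}𝒪*`), L. 12.7.2 (proof) p. 193.
* [vanDijk1972] G. van Dijk, *Computation of certain induced characters of 𝔭-adic groups*, Math. Ann. 199 (1972), §2 (the open set `Ad(G)(A′)` of split-regular elements).
* [PlatonovRapinchuk1994] V. Platonov, A. Rapinchuk, *Algebraic Groups and Number Theory* (1994), §5.1 (one place above a non-split `v`).
-/

set_option autoImplicit false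
-- the mandated namespace has the single-problem summit's repeated segment (`HodgeConjecture.HodgeConjecture`)
set_option linter.dupNamespace false

noncomputable section

open NumberField IsDedekindDomain Matrix
open scoped MatrixGroups Pointwise
open Literature.NumberTheory.Rogawski1990 Literature.NumberTheory.Automorphic Literature.NumberTheory.Automorphic.UnitaryGroup
open Summit.HodgeConjecture.HodgeConjecture.Cruxes.H413.F0P3cStCharTSTorusDefs
open Summit.HodgeConjecture.HodgeConjecture.Cruxes.H413.F0P3cStCharTSTorusCompactPart
open Summit.HodgeConjecture.HodgeConjecture.Cruxes.H413.F0P3cStCharTSTorusRay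

namespace Summit.HodgeConjecture.HodgeConjecture.Cruxes.H413.F0P3cStCharTSHyperbolicSet

variable (L : Type) [Field L] [NumberField L] [IsCMField L] (v : HeightOneSpectrum (𝓞 ↥(maximalRealSubfield L)))

/-! ## §1 (H1) `hyperbolicSet` is conjugation-invariant and regular -/

/-- **(H1a) `Ω` is conjugation-invariant**: `g ∈ Ω ⇒ h g h⁻¹ ∈ Ω` (a conjugate of a conjugate of a regular `t ∈ T` is a conjugate of `t`). [cite: Rogawski1990, §12.5 p. 182] -/
theorem conj_mem_hyperbolicSet {g : Gqs L v} (hg : g ∈ hyperbolicSet L v) (h : Gqs L v) : h * g * h⁻¹ ∈ hyperbolicSet L v := by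
  obtain ⟨t, ht, hc⟩ := hg
  exact ⟨t, ht, hc.trans (isConj_iff.2 ⟨h, rfl⟩)⟩

/-- (H1a′) the `iff` form: `h g h⁻¹ ∈ Ω ↔ g ∈ Ω`. [cite: Rogawski1990, §12.5 p. 182] -/
theorem conj_mem_hyperbolicSet_iff (g h : Gqs L v) : h * g * h⁻¹ ∈ hyperbolicSet L v ↔ g ∈ hyperbolicSet L v := by
  refine ⟨fun hg => ?_, fun hg => conj_mem_hyperbolicSet L v hg h⟩
  have e : h⁻¹ * (h * g * h⁻¹) * h⁻¹⁻¹ = g := by group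
  rw [← e]
  exact conj_mem_hyperbolicSet L v hg h⁻¹

/-- **(H1b) `Ω` consists of REGULAR elements** (regularity is a class function, ★ `isRegularElt_of_isConj`). [cite: Rogawski1990, §3.1 p. 19; §12.5 p. 182] -/
theorem isRegularElt_of_mem_hyperbolicSet {g : Gqs L v} (hg : g ∈ hyperbolicSet L v) : IsRegularElt (g.val : GL (Fin 3) (LocalRing L v)) := by
  obtain ⟨t, ht, hc⟩ := hg
  exact isRegularElt_of_isConj
    ((unitaryGroupOfForm (conjLocal L (IsCMField.complexConj L) v) (cmLocalForm L 3 v)).subtype.map_isConj hc) ht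

/-- (H1b′) as an inclusion: `Ω ⊆ {γ | γ regular}`. [cite: Rogawski1990, §3.1 p. 19; §12.5 p. 182] -/
theorem hyperbolicSet_subset_setOf_isRegularElt : hyperbolicSet L v ⊆ {γ : Gqs L v | IsRegularElt (γ.val : GL (Fin 3) (LocalRing L v))} :=
  fun _ hg => isRegularElt_of_mem_hyperbolicSet L v hg

/-! ## §2 (H2) The trace-open core `Ω° = {γ | 1 < |(tr γ)_w|}` -/

omit [IsCMField L] in
/-- `{x ∈ L_w : 1 < |x|}` is open (the complement of the closed unit ball, which is closed). [cite: PlatonovRapinchuk1994, §5.1] -/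
theorem isOpen_setOf_one_lt_v (w : PlacesOver L v) : IsOpen {x : w.1.adicCompletion L | 1 < Valued.v x} := by
  have h : {x : w.1.adicCompletion L | 1 < Valued.v x} = (((Valued.v : Valuation (w.1.adicCompletion L) (WithZero (Multiplicative ℤ)))).integer : Set (w.1.adicCompletion L))ᶜ := by
    ext x
    rw [Set.mem_setOf_eq, Set.mem_compl_iff, SetLike.mem_coe, Valuation.mem_integer_iff, not_le]
  rw [h]
  exact (Valued.isClosed_integer (w.1.adicCompletion L)).isOpen_compl

/-- `γ ↦ (tr γ)_w` is continuous on `U(Φ₃)(L⁺_v)`. [cite: PlatonovRapinchuk1994, §5.1] -/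
theorem continuous_eval_trace (w : PlacesOver L v) :
    Continuous fun γ : Gqs L v => (Pi.evalRingHom (fun w' : PlacesOver L v => w'.1.adicCompletion L) w) ((γ.val : GL (Fin 3) (LocalRing L v)) : Matrix (Fin 3) (Fin 3) (LocalRing L v)).trace :=
  (continuous_apply w).comp ((Units.continuous_val.comp continuous_subtype_val).matrix_trace)

/-- **(H2a) `Ω°` IS OPEN.** [cite: Rogawski1990, §12.5 p. 182] [cite: vanDijk1972, §2] -/
theorem isOpen_setOf_one_lt_v_trace (w : PlacesOver L v) :
    IsOpen {γ : Gqs L v | 1 < Valued.v ((Pi.evalRingHom (fun w' : PlacesOver L v => w'.1.adicCompletion L) w) ((γ.val : GL (Fin 3) (LocalRing L v)) : Matrix (Fin 3) (Fin 3) (LocalRing L v)).trace)} :=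
  (isOpen_setOf_one_lt_v L v w).preimage (continuous_eval_trace L v w)

/-- `tr (h γ h⁻¹) = tr γ` on `U(Φ₃)(L⁺_v)` (organ carrier `Gqs L v`). [cite: Rogawski1990, §3.1 p. 19] -/
theorem trace_conj (γ h : Gqs L v) :
    (((h * γ * h⁻¹ : Gqs L v).val : GL (Fin 3) (LocalRing L v)) : Matrix (Fin 3) (Fin 3) (LocalRing L v)).trace = ((γ.val : GL (Fin 3) (LocalRing L v)) : Matrix (Fin 3) (Fin 3) (LocalRing L v)).trace := by
  show (((h.val * γ.val * h.val⁻¹ : GL (Fin 3) (LocalRing L v))) : Matrix (Fin 3) (Fin 3) (LocalRing L v)).trace = _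
  rw [Units.val_mul, Units.val_mul]
  exact Matrix.trace_units_conj _ _

/-- `tr (h γ h⁻¹) = tr γ` on `U(Φ₃)(L⁺_v)` (subgroup carrier `↥(unitaryGroupOfForm (c ⊗ 1) (cmLocalForm L 3 v))`, the home of `torusChart` and of XIG's `𝓝 1`). [cite: Rogawski1990, §3.1 p. 19] -/
theorem trace_conj' (γ h : ↥(unitaryGroupOfForm (conjLocal L (IsCMField.complexConj L) v) (cmLocalForm L 3 v))) :
    (((h * γ * h⁻¹ : ↥(unitaryGroupOfForm (conjLocal L (IsCMField.complexConj L) v) (cmLocalForm L 3 v))) : GL (Fin 3) (LocalRing L v)) : Matrix (Fin 3) (Fin 3) (LocalRing L v)).trace =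
      ((γ : GL (Fin 3) (LocalRing L v)) : Matrix (Fin 3) (Fin 3) (LocalRing L v)).trace := by
  rw [Subgroup.coe_mul, Subgroup.coe_mul, Subgroup.coe_inv, Units.val_mul, Units.val_mul]
  exact Matrix.trace_units_conj _ _

/-- **(H2b) `Ω°` IS CONJUGATION-INVARIANT**: `h γ h⁻¹ ∈ Ω° ↔ γ ∈ Ω°`. [cite: Rogawski1990, §12.5 p. 182] -/
theorem conj_mem_setOf_one_lt_v_trace_iff (w : PlacesOver L v) (γ h : Gqs L v) :
    h * γ * h⁻¹ ∈ {γ : Gqs L v | 1 < Valued.v ((Pi.evalRingHom (fun w' : PlacesOver L v => w'.1.adicCompletion L) w) ((γ.val : GL (Fin 3) (LocalRing L v)) : Matrix (Fin 3) (Fin 3) (LocalRing L v)).trace)} ↔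
      γ ∈ {γ : Gqs L v | 1 < Valued.v ((Pi.evalRingHom (fun w' : PlacesOver L v => w'.1.adicCompletion L) w) ((γ.val : GL (Fin 3) (LocalRing L v)) : Matrix (Fin 3) (Fin 3) (LocalRing L v)).trace)} := by
  rw [Set.mem_setOf_eq, Set.mem_setOf_eq, trace_conj]

/-! ### The chart `ι(α, z) = d(α, zσ(α)α⁻¹, σ(α)⁻¹)`: `|tr ι(α,z)|_w > 1 ⟺ |α_w| ≠ 1` at a non-split `v` -/

omit [IsCMField L] in
/-- Units of `E_v`: `|(u⁻¹)_w| = |u_w|⁻¹`. [folklore] -/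
theorem v_units_inv_apply (u : (LocalRing L v)ˣ) (w : PlacesOver L v) :
    Valued.v (((u⁻¹ : (LocalRing L v)ˣ) : LocalRing L v) w) = (Valued.v ((u : LocalRing L v) w))⁻¹ := by
  have hprod : Valued.v (((u⁻¹ : (LocalRing L v)ˣ) : LocalRing L v) w) * Valued.v ((u : LocalRing L v) w) = 1 := by
    rw [← map_mul, ← Pi.mul_apply, Units.inv_mul, Pi.one_apply, map_one]
  exact eq_inv_of_mul_eq_one_left hprod

/-- At a NON-SPLIT `v` (one place `w ∣ v`): `|(σ x)_w| = |x_w|` (★ `conjLocal_apply_eq_of_smul_eq`, ★ `valued_galAdicCompletionMap`). [cite: PlatonovRapinchuk1994, §5.1] -/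
theorem v_conjLocal_apply_of_nonsplit (hns : ∀ w : PlacesOver L v, IsCMField.complexConj L • w.1 = w.1) (x : LocalRing L v) (w : PlacesOver L v) :
    Valued.v (conjLocal L (IsCMField.complexConj L) v x w) = Valued.v (x w) := by
  haveI : Algebra.IsQuadraticExtension ↥(maximalRealSubfield L) L := IsCMField.isQuadraticExtension L
  rw [conjLocal_apply_eq_of_smul_eq (IsCMField.complexConj L) (IsCMField.complexConj_ne_one L) v w (hns w), valued_galAdicCompletionMap]

/-- The `w`-valuations of the three chart entries: `|α_w|`, `1`, `|α_w|⁻¹`. [cite: Rogawski1990, §12.2 p. 173] -/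
theorem v_torusChartEntries_apply (hns : ∀ w : PlacesOver L v, IsCMField.complexConj L • w.1 = w.1)
    (m : (LocalRing L v)ˣ × ↥(normOneUnits (conjLocal L (IsCMField.complexConj L) v))) (w : PlacesOver L v) :
    Valued.v (((torusChartEntries L v m 0 : (LocalRing L v)ˣ) : LocalRing L v) w) = Valued.v ((m.1 : LocalRing L v) w) ∧
      Valued.v (((torusChartEntries L v m 1 : (LocalRing L v)ˣ) : LocalRing L v) w) = 1 ∧
      Valued.v (((torusChartEntries L v m 2 : (LocalRing L v)ˣ) : LocalRing L v) w) = (Valued.v ((m.1 : LocalRing L v) w))⁻¹ := by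
  have hσ : Valued.v (((Units.map ((conjLocal L (IsCMField.complexConj L) v : LocalRing L v →+* LocalRing L v) : LocalRing L v →* LocalRing L v) m.1 : (LocalRing L v)ˣ) :
      LocalRing L v) w) = Valued.v ((m.1 : LocalRing L v) w) := by
    rw [Units.coe_map, MonoidHom.coe_coe]
    exact v_conjLocal_apply_of_nonsplit L v hns _ w
  have hz : Valued.v (((m.2 : (LocalRing L v)ˣ) : LocalRing L v) w) = 1 := valued_apply_eq_one_of_mem_normOneUnits L v hns m.2.2 w
  have h0 : Valued.v ((m.1 : LocalRing L v) w) ≠ 0 := (Valuation.ne_zero_iff _).2 (coe_apply_ne_zero L v m.1 w)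
  refine ⟨rfl, ?_, ?_⟩
  · show Valued.v ((((m.2 : (LocalRing L v)ˣ) * Units.map ((conjLocal L (IsCMField.complexConj L) v : LocalRing L v →+* LocalRing L v) : LocalRing L v →* LocalRing L v) m.1 * m.1⁻¹ :
        (LocalRing L v)ˣ) : LocalRing L v) w) = 1
    rw [Units.val_mul, Units.val_mul, Pi.mul_apply, Pi.mul_apply, map_mul, map_mul, hz, hσ, v_units_inv_apply, one_mul, mul_inv_cancel₀ h0]
  · show Valued.v ((((Units.map ((conjLocal L (IsCMField.complexConj L) v : LocalRing L v →+* LocalRing L v) : LocalRing L v →* LocalRing L v) m.1)⁻¹ :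
        (LocalRing L v)ˣ) : LocalRing L v) w) = _
    rw [v_units_inv_apply, hσ]

/-- The trace of the chart, read at `w`: `(tr ι m)_w = Σ_i (dᵢ)_w`. [cite: Rogawski1990, §12.2 p. 173] -/
theorem eval_trace_torusChart (m : (LocalRing L v)ˣ × ↥(normOneUnits (conjLocal L (IsCMField.complexConj L) v))) (w : PlacesOver L v) :
    (Pi.evalRingHom (fun w' : PlacesOver L v => w'.1.adicCompletion L) w) (((((torusChart L v m : ↥(cmBorelTriple L 3 v).M) : ↥(unitaryGroupOfForm (conjLocal L (IsCMField.complexConj L) v) (cmLocalForm L 3 v))) : GL (Fin 3) (LocalRing L v)) : Matrix (Fin 3) (Fin 3) (LocalRing L v)).trace) =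
      ((torusChartEntries L v m 0 : (LocalRing L v)ˣ) : LocalRing L v) w + ((torusChartEntries L v m 1 : (LocalRing L v)ˣ) : LocalRing L v) w +
        ((torusChartEntries L v m 2 : (LocalRing L v)ˣ) : LocalRing L v) w := by
  show (((glDiagonal 3 (LocalRing L v) (torusChartEntries L v m) : GL (Fin 3) (LocalRing L v)) : Matrix (Fin 3) (Fin 3) (LocalRing L v)).trace) w = _
  rw [coe_glDiagonal, Matrix.trace_diagonal, Fin.sum_univ_three, Pi.add_apply, Pi.add_apply]

omit [IsCMField L] in
/-- **Ultrametric trichotomy**: for `x y z ∈ L_w` with `|x| = a`, `|y| = 1`, `|z| = a⁻¹` (`a ≠ 0`): `1 < |x + y + z| ⟺ a ≠ 1`. [folklore] -/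
theorem one_lt_v_add_add_iff {w : PlacesOver L v} {x y z : w.1.adicCompletion L} {a : WithZero (Multiplicative ℤ)} (ha : a ≠ 0)
    (hx : Valued.v x = a) (hy : Valued.v y = 1) (hz : Valued.v z = a⁻¹) : 1 < Valued.v (x + y + z) ↔ a ≠ 1 := by
  have ha0 : 0 < a := zero_lt_iff.2 ha
  constructor
  · rintro hlt rfl
    have h1 : Valued.v (x + y + z) ≤ 1 := by
      refine Valuation.map_add_le _ (Valuation.map_add_le _ hx.le hy.le) ?_
      rw [hz, inv_one]
    exact (not_lt.2 h1) hlt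
  · intro hne
    rcases lt_or_gt_of_ne hne with hlt | hgt
    · -- `a < 1`: the term `z` dominates, `|x + y + z| = a⁻¹ > 1`
      have hz1 : 1 < Valued.v z := by rw [hz]; exact (one_lt_inv₀ ha0).2 hlt
      have hxy : Valued.v (x + y) < Valued.v z := lt_of_le_of_lt (Valuation.map_add_le _ (hx.le.trans hlt.le) hy.le) hz1
      rw [Valuation.map_add_eq_of_lt_right _ hxy]
      exact hz1
    · -- `1 < a`: the term `x` dominates, `|x + y + z| = a > 1`
      have hx1 : 1 < Valued.v x := by rw [hx]; exact hgt
      have hz1 : Valued.v z < 1 := by rw [hz]; exact (inv_lt_one₀ ha0).2 hgt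
      have hyz : Valued.v (y + z) < Valued.v x := lt_of_le_of_lt (Valuation.map_add_le _ hy.le hz1.le) hx1
      rw [add_assoc, Valuation.map_add_eq_of_lt_left _ hyz]
      exact hx1

/-- **(H2c) THE CHART AND THE CORE**: at a NON-SPLIT `v`, `ι(α, z) ∈ Ω° ⟺ |α_w| ≠ 1` (entries of valuation `|α|, 1, |α|⁻¹`; ultrametric trichotomy).  Stated as the core's
defining inequality at the chart point (membership in `{γ | 1 < |(tr γ)_w|}` is this by `Iff.rfl`). [cite: Rogawski1990, §12.2 p. 173; §12.7 L. 12.7.1 (proof) p. 191] -/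
theorem one_lt_v_trace_torusChart_iff (hns : ∀ w : PlacesOver L v, IsCMField.complexConj L • w.1 = w.1) (w : PlacesOver L v) (m : (LocalRing L v)ˣ × ↥(normOneUnits (conjLocal L (IsCMField.complexConj L) v))) :
    1 < Valued.v ((Pi.evalRingHom (fun w' : PlacesOver L v => w'.1.adicCompletion L) w) (((((torusChart L v m : ↥(cmBorelTriple L 3 v).M) : ↥(unitaryGroupOfForm (conjLocal L (IsCMField.complexConj L) v) (cmLocalForm L 3 v))) : GL (Fin 3) (LocalRing L v)) : Matrix (Fin 3) (Fin 3) (LocalRing L v)).trace)) ↔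
      Valued.v ((m.1 : LocalRing L v) w) ≠ 1 := by
  obtain ⟨h0, h1, h2⟩ := v_torusChartEntries_apply L v hns m w
  rw [eval_trace_torusChart]
  exact one_lt_v_add_add_iff L v ((Valuation.ne_zero_iff _).2 (coe_apply_ne_zero L v m.1 w)) h0 h1 h2

/-- **A point of a NON-UNIT SHELL has a non-unit first coordinate**: `m₀ ∉ M_c = 𝒪_vˣ × E¹_v`, `m ∈ m₀ • M_c` ⇒ `|(m.1)_w| ≠ 1` at the (unique) place `w` of a non-split `v`.
[cite: Rogawski1990, §12.7 L. 12.7.1 (proof) p. 191] -/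
theorem v_fst_apply_ne_one_of_mem_smul_torusCompactPart (hns : ∀ w : PlacesOver L v, IsCMField.complexConj L • w.1 = w.1) (w : PlacesOver L v)
    {m₀ m : (LocalRing L v)ˣ × ↥(normOneUnits (conjLocal L (IsCMField.complexConj L) v))}
    (hm₀ : m₀ ∉ ((Submonoid.pi Set.univ (fun w : PlacesOver L v => (w.1.adicCompletionIntegers L).toSubring.toSubmonoid)).units.prod (⊤ : Subgroup ↥(normOneUnits (conjLocal L (IsCMField.complexConj L) v)))))
    (hm : m ∈ m₀ • ((((Submonoid.pi Set.univ (fun w : PlacesOver L v => (w.1.adicCompletionIntegers L).toSubring.toSubmonoid)).units.prod (⊤ : Subgroup ↥(normOneUnits (conjLocal L (IsCMField.complexConj L) v)))) :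
      Subgroup ((LocalRing L v)ˣ × ↥(normOneUnits (conjLocal L (IsCMField.complexConj L) v)))) : Set ((LocalRing L v)ˣ × ↥(normOneUnits (conjLocal L (IsCMField.complexConj L) v))))) :
    Valued.v ((m.1 : LocalRing L v) w) ≠ 1 := by
  haveI : Algebra.IsQuadraticExtension ↥(maximalRealSubfield L) L := IsCMField.isQuadraticExtension L
  haveI := PlacesOver.subsingleton_of_smul_eq (IsCMField.complexConj L) (IsCMField.complexConj_ne_one L) w (hns w)
  -- `m₀.1 ∉ 𝒪_vˣ`: its `w`-component is not a unit (one place above `v`)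
  have h₀ : Valued.v ((m₀.1 : LocalRing L v) w) ≠ 1 := by
    intro h1
    refine hm₀ (Subgroup.mem_prod.2 ⟨(mem_unitsIntegers_iff L v m₀.1).2 fun w' => ?_, Subgroup.mem_top _⟩)
    rw [Subsingleton.elim w' w]; exact h1
  -- `m = m₀ * u` with `u ∈ M_c`, so `|(m.1)_w| = |(m₀.1)_w| · 1`
  obtain ⟨u, hu, rfl⟩ := Set.mem_smul_set.1 hm
  have hu1 : Valued.v ((u.1 : LocalRing L v) w) = 1 := (mem_unitsIntegers_iff L v u.1).1 (Subgroup.mem_prod.1 hu).1 w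
  rw [smul_eq_mul, Prod.fst_mul, Units.val_mul, Pi.mul_apply, map_mul, hu1, mul_one]
  exact h₀

/-- **(H2d) NON-UNIT SHELLS CHART INTO THE CORE**: `m₀ ∉ M_c`, `m ∈ m₀ • M_c` ⇒ `ι m ∈ Ω°` — the (SHF′) shells `η^{±m}𝒪* × E¹` of L. 12.7.1 live in the trace-open core.
[cite: Rogawski1990, §12.7 L. 12.7.1 (proof) p. 191; L. 12.7.2 (proof) p. 193] -/
theorem one_lt_v_trace_torusChart_of_mem_smul_torusCompactPart (hns : ∀ w : PlacesOver L v, IsCMField.complexConj L • w.1 = w.1) (w : PlacesOver L v)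
    {m₀ m : (LocalRing L v)ˣ × ↥(normOneUnits (conjLocal L (IsCMField.complexConj L) v))}
    (hm₀ : m₀ ∉ ((Submonoid.pi Set.univ (fun w : PlacesOver L v => (w.1.adicCompletionIntegers L).toSubring.toSubmonoid)).units.prod (⊤ : Subgroup ↥(normOneUnits (conjLocal L (IsCMField.complexConj L) v)))))
    (hm : m ∈ m₀ • ((((Submonoid.pi Set.univ (fun w : PlacesOver L v => (w.1.adicCompletionIntegers L).toSubring.toSubmonoid)).units.prod (⊤ : Subgroup ↥(normOneUnits (conjLocal L (IsCMField.complexConj L) v)))) :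
      Subgroup ((LocalRing L v)ˣ × ↥(normOneUnits (conjLocal L (IsCMField.complexConj L) v)))) : Set ((LocalRing L v)ˣ × ↥(normOneUnits (conjLocal L (IsCMField.complexConj L) v))))) :
    1 < Valued.v ((Pi.evalRingHom (fun w' : PlacesOver L v => w'.1.adicCompletion L) w) (((((torusChart L v m : ↥(cmBorelTriple L 3 v).M) : ↥(unitaryGroupOfForm (conjLocal L (IsCMField.complexConj L) v) (cmLocalForm L 3 v))) : GL (Fin 3) (LocalRing L v)) : Matrix (Fin 3) (Fin 3) (LocalRing L v)).trace)) :=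
  (one_lt_v_trace_torusChart_iff L v hns w m).2 (v_fst_apply_ne_one_of_mem_smul_torusCompactPart L v hns w hm₀ hm)

/-- **(H2e) … AND SO DO ALL THEIR CONJUGATES**: `m₀ ∉ M_c`, `m ∈ m₀ • M_c`, `h ∈ U(Φ₃)(L⁺_v)` ⇒ `h (ι m) h⁻¹ ∈ Ω°` ((H2b) ∘ (H2d)).
[cite: Rogawski1990, §12.5 p. 182; §12.7 L. 12.7.1 (proof) p. 191] -/
theorem one_lt_v_trace_conj_torusChart_of_mem_smul_torusCompactPart (hns : ∀ w : PlacesOver L v, IsCMField.complexConj L • w.1 = w.1) (w : PlacesOver L v)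
    {m₀ m : (LocalRing L v)ˣ × ↥(normOneUnits (conjLocal L (IsCMField.complexConj L) v))}
    (hm₀ : m₀ ∉ ((Submonoid.pi Set.univ (fun w : PlacesOver L v => (w.1.adicCompletionIntegers L).toSubring.toSubmonoid)).units.prod (⊤ : Subgroup ↥(normOneUnits (conjLocal L (IsCMField.complexConj L) v)))))
    (hm : m ∈ m₀ • ((((Submonoid.pi Set.univ (fun w : PlacesOver L v => (w.1.adicCompletionIntegers L).toSubring.toSubmonoid)).units.prod (⊤ : Subgroup ↥(normOneUnits (conjLocal L (IsCMField.complexConj L) v)))) :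
      Subgroup ((LocalRing L v)ˣ × ↥(normOneUnits (conjLocal L (IsCMField.complexConj L) v)))) : Set ((LocalRing L v)ˣ × ↥(normOneUnits (conjLocal L (IsCMField.complexConj L) v)))))
    (h : ↥(unitaryGroupOfForm (conjLocal L (IsCMField.complexConj L) v) (cmLocalForm L 3 v))) :
    1 < Valued.v ((Pi.evalRingHom (fun w' : PlacesOver L v => w'.1.adicCompletion L) w) ((((h * ((torusChart L v m : ↥(cmBorelTriple L 3 v).M) : ↥(unitaryGroupOfForm (conjLocal L (IsCMField.complexConj L) v) (cmLocalForm L 3 v))) * h⁻¹ : ↥(unitaryGroupOfForm (conjLocal L (IsCMField.complexConj L) v) (cmLocalForm L 3 v))) : GL (Fin 3) (LocalRing L v)) : Matrix (Fin 3) (Fin 3) (LocalRing L v)).trace)) := by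
  rw [trace_conj']
  exact one_lt_v_trace_torusChart_of_mem_smul_torusCompactPart L v hns w hm₀ hm

/-- **(H2d) in set form on the organ carrier**: the chart point, read in `Gqs L v`, lies in `Ω° = {γ | 1 < |(tr γ)_w|}`. [cite: Rogawski1990, §12.7 L. 12.7.1 (proof) p. 191] -/
theorem torusChart_mem_setOf_one_lt_v_trace_of_mem_smul_torusCompactPart (hns : ∀ w : PlacesOver L v, IsCMField.complexConj L • w.1 = w.1) (w : PlacesOver L v)
    {m₀ m : (LocalRing L v)ˣ × ↥(normOneUnits (conjLocal L (IsCMField.complexConj L) v))}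
    (hm₀ : m₀ ∉ ((Submonoid.pi Set.univ (fun w : PlacesOver L v => (w.1.adicCompletionIntegers L).toSubring.toSubmonoid)).units.prod (⊤ : Subgroup ↥(normOneUnits (conjLocal L (IsCMField.complexConj L) v)))))
    (hm : m ∈ m₀ • ((((Submonoid.pi Set.univ (fun w : PlacesOver L v => (w.1.adicCompletionIntegers L).toSubring.toSubmonoid)).units.prod (⊤ : Subgroup ↥(normOneUnits (conjLocal L (IsCMField.complexConj L) v)))) :
      Subgroup ((LocalRing L v)ˣ × ↥(normOneUnits (conjLocal L (IsCMField.complexConj L) v)))) : Set ((LocalRing L v)ˣ × ↥(normOneUnits (conjLocal L (IsCMField.complexConj L) v))))) :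
    (⟨((((torusChart L v m : ↥(cmBorelTriple L 3 v).M) : ↥(unitaryGroupOfForm (conjLocal L (IsCMField.complexConj L) v) (cmLocalForm L 3 v))) : GL (Fin 3) (LocalRing L v))), (((torusChart L v m : ↥(cmBorelTriple L 3 v).M) : ↥(unitaryGroupOfForm (conjLocal L (IsCMField.complexConj L) v) (cmLocalForm L 3 v)))).2⟩ : Gqs L v) ∈
      {γ : Gqs L v | 1 < Valued.v ((Pi.evalRingHom (fun w' : PlacesOver L v => w'.1.adicCompletion L) w) (((γ.val : GL (Fin 3) (LocalRing L v)) : Matrix (Fin 3) (Fin 3) (LocalRing L v)).trace))} :=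
  one_lt_v_trace_torusChart_of_mem_smul_torusCompactPart L v hns w hm₀ hm

/-- **(H2f) the torus-level reading**: if the chart point `ι m` lies in the core `Ω°`, its first torus entry `torusEntry 0 (ι m) = α` is a NON-UNIT at `w` (`|α_w| ≠ 1`).
[cite: Rogawski1990, §12.2 p. 173] -/
theorem v_torusEntry_zero_ne_one_of_one_lt_v_trace (hns : ∀ w : PlacesOver L v, IsCMField.complexConj L • w.1 = w.1) (w : PlacesOver L v) (m : (LocalRing L v)ˣ × ↥(normOneUnits (conjLocal L (IsCMField.complexConj L) v)))
    (hm : 1 < Valued.v ((Pi.evalRingHom (fun w' : PlacesOver L v => w'.1.adicCompletion L) w) (((((torusChart L v m : ↥(cmBorelTriple L 3 v).M) : ↥(unitaryGroupOfForm (conjLocal L (IsCMField.complexConj L) v) (cmLocalForm L 3 v))) : GL (Fin 3) (LocalRing L v)) : Matrix (Fin 3) (Fin 3) (LocalRing L v)).trace))) :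
    Valued.v (((torusEntry (conjLocal L (IsCMField.complexConj L) v) (cmLocalForm L 3 v) 0 (torusChart L v m) : (LocalRing L v)ˣ) : LocalRing L v) w) ≠ 1 := by
  rw [torusEntry_zero_torusChart]
  exact (one_lt_v_trace_torusChart_iff L v hns w m).1 hm

/-! ## §3 (H2g, ED. 2) Double cosets of a deep-level subgroup around a non-unit torus point lie in the core `Ω°` -/

omit [IsCMField L] in
/-- A deep-level element has UNIT diagonal at `w`: `|(k_ii − 1)_w| ≤ r < 1 ⇒ |(k_ii)_w| = 1`. [folklore] -/
theorem v_eval_apply_diag_eq_one_of_level {w : PlacesOver L v} {r : WithZero (Multiplicative ℤ)} (hr : r < 1)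
    {k : Matrix (Fin 3) (Fin 3) (LocalRing L v)} (i : Fin 3)
    (hk : Valued.v ((Pi.evalRingHom (fun w' : PlacesOver L v => w'.1.adicCompletion L) w) (k i i - (1 : Matrix (Fin 3) (Fin 3) (LocalRing L v)) i i)) ≤ r) :
    Valued.v ((Pi.evalRingHom (fun w' : PlacesOver L v => w'.1.adicCompletion L) w) (k i i)) = 1 := by
  have h : (Pi.evalRingHom (fun w' : PlacesOver L v => w'.1.adicCompletion L) w) (k i i) =
      1 + (Pi.evalRingHom (fun w' : PlacesOver L v => w'.1.adicCompletion L) w) (k i i - (1 : Matrix (Fin 3) (Fin 3) (LocalRing L v)) i i) := by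
    rw [map_sub, Matrix.one_apply_eq, map_one, add_sub_cancel]
  rw [h]
  exact Valuation.map_one_add_of_lt _ (lt_of_le_of_lt hk hr)

/-- `tr (k · diag d · k′) = Σᵢ dᵢ · (k′k)ᵢᵢ` (cyclicity of the trace). [folklore] -/
theorem trace_mul_diagonal_mul_eq {R : Type*} [CommRing R] (k k' : Matrix (Fin 3) (Fin 3) R) (d : Fin 3 → R) :
    (k * Matrix.diagonal d * k').trace = d 0 * (k' * k) 0 0 + d 1 * (k' * k) 1 1 + d 2 * (k' * k) 2 2 := by
  rw [Matrix.trace_mul_cycle, Matrix.trace, Fin.sum_univ_three]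
  simp only [Matrix.diag_apply, Matrix.mul_apply, Matrix.diagonal_apply, Fin.sum_univ_three]
  simp only [Fin.isValue, ↓reduceIte, Fin.reduceEq, mul_zero, add_zero, zero_add]
  ring

/-- **(H2g) DEEP-LEVEL DOUBLE COSETS OF A NON-UNIT CHART POINT LIE IN THE CORE.**  Let `Kn ≤ U(Φ₃)(L⁺_v)` be a subgroup of DEEP LEVEL at `w` (`|(k_ij − δ_ij)_w| ≤ r < 1` for all
`k ∈ Kn`; e.g. a principal congruence subgroup `K_n`, `n ≥ 1`, as in road (D)) and `ι m` a chart point with `|(m.1)_w| ≠ 1` (a point of a NON-UNIT SHELL).  Then every element of the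
double coset `Kn · ι m · Kn` has `|tr|_w > 1`: `tr(k·ι m·k′) = Σ dᵢ (k′k)ᵢᵢ` with `|(k′k)ᵢᵢ|_w = 1` and `|dᵢ|_w = |α|, 1, |α|⁻¹` (ultrametric trichotomy) — the support of the Hecke-shell test
function `𝟙_{K_n ι(u) K_n}` of «SURJ-HECKE★» lies in `Ω°`. [cite: Rogawski1990, §12.7 L. 12.7.1 (proof) p. 191; L. 12.7.3 (proof) p. 195] [cite: vanDijk1972, §2] -/
theorem one_lt_v_trace_of_mem_doubleCoset_torusChart (hns : ∀ w : PlacesOver L v, IsCMField.complexConj L • w.1 = w.1) (w : PlacesOver L v)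
    (Kn : Subgroup ↥(unitaryGroupOfForm (conjLocal L (IsCMField.complexConj L) v) (cmLocalForm L 3 v))) {r : WithZero (Multiplicative ℤ)} (hr : r < 1)
    (hK : ∀ k : ↥(unitaryGroupOfForm (conjLocal L (IsCMField.complexConj L) v) (cmLocalForm L 3 v)), k ∈ Kn → ∀ i j : Fin 3,
      Valued.v ((Pi.evalRingHom (fun w' : PlacesOver L v => w'.1.adicCompletion L) w)
        ((k : GL (Fin 3) (LocalRing L v)).val i j - (1 : Matrix (Fin 3) (Fin 3) (LocalRing L v)) i j)) ≤ r)
    (m : (LocalRing L v)ˣ × ↥(normOneUnits (conjLocal L (IsCMField.complexConj L) v))) (hm : Valued.v ((m.1 : LocalRing L v) w) ≠ 1)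
    {x : ↥(unitaryGroupOfForm (conjLocal L (IsCMField.complexConj L) v) (cmLocalForm L 3 v))}
    (hx : x ∈ DoubleCoset.doubleCoset ((torusChart L v m : ↥(cmBorelTriple L 3 v).M) : ↥(unitaryGroupOfForm (conjLocal L (IsCMField.complexConj L) v) (cmLocalForm L 3 v)))
      (Kn : Set ↥(unitaryGroupOfForm (conjLocal L (IsCMField.complexConj L) v) (cmLocalForm L 3 v))) Kn) :
    1 < Valued.v ((Pi.evalRingHom (fun w' : PlacesOver L v => w'.1.adicCompletion L) w) (((x : GL (Fin 3) (LocalRing L v)) : Matrix (Fin 3) (Fin 3) (LocalRing L v)).trace)) := by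
  obtain ⟨k, hk, k', hk', rfl⟩ := DoubleCoset.mem_doubleCoset.1 hx
  obtain ⟨h0, h1, h2⟩ := v_torusChartEntries_apply L v hns m w
  have ha0 : Valued.v ((m.1 : LocalRing L v) w) ≠ 0 := (Valuation.ne_zero_iff _).2 (coe_apply_ne_zero L v m.1 w)
  -- the product `k′k ∈ Kn` has unit diagonal at `w`
  have hkk : k' * k ∈ Kn := Kn.mul_mem hk' hk
  have hdiag : ∀ i : Fin 3, Valued.v ((Pi.evalRingHom (fun w' : PlacesOver L v => w'.1.adicCompletion L) w)
      ((((k' : GL (Fin 3) (LocalRing L v)) : Matrix (Fin 3) (Fin 3) (LocalRing L v)) * ((k : GL (Fin 3) (LocalRing L v)) : Matrix (Fin 3) (Fin 3) (LocalRing L v))) i i)) = 1 := by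
    intro i
    have h := hK (k' * k) hkk i i
    rw [Subgroup.coe_mul, Units.val_mul] at h
    exact v_eval_apply_diag_eq_one_of_level L v hr i h
  rw [Subgroup.coe_mul, Subgroup.coe_mul, Units.val_mul, Units.val_mul, coe_torusChart, coe_glDiagonal, trace_mul_diagonal_mul_eq]
  simp only [map_add, map_mul]
  refine (one_lt_v_add_add_iff L v ha0 ?_ ?_ ?_).2 hm
  · rw [map_mul, hdiag 0, mul_one]; exact h0
  · rw [map_mul, hdiag 1, mul_one]; exact h1
  · rw [map_mul, hdiag 2, mul_one]; exact h2

/-- **(H2g) in set form**: `Kn · ι m · Kn ⊆ Ω°` (on the subgroup carrier `U`; as a `Set (Gqs L v)` this is the same set). [cite: Rogawski1990, §12.7 L. 12.7.1 (proof) p. 191] -/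
theorem doubleCoset_torusChart_subset_setOf_one_lt_v_trace (hns : ∀ w : PlacesOver L v, IsCMField.complexConj L • w.1 = w.1) (w : PlacesOver L v)
    (Kn : Subgroup ↥(unitaryGroupOfForm (conjLocal L (IsCMField.complexConj L) v) (cmLocalForm L 3 v))) {r : WithZero (Multiplicative ℤ)} (hr : r < 1)
    (hK : ∀ k : ↥(unitaryGroupOfForm (conjLocal L (IsCMField.complexConj L) v) (cmLocalForm L 3 v)), k ∈ Kn → ∀ i j : Fin 3,
      Valued.v ((Pi.evalRingHom (fun w' : PlacesOver L v => w'.1.adicCompletion L) w)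
        ((k : GL (Fin 3) (LocalRing L v)).val i j - (1 : Matrix (Fin 3) (Fin 3) (LocalRing L v)) i j)) ≤ r)
    (m : (LocalRing L v)ˣ × ↥(normOneUnits (conjLocal L (IsCMField.complexConj L) v))) (hm : Valued.v ((m.1 : LocalRing L v) w) ≠ 1) :
    DoubleCoset.doubleCoset ((torusChart L v m : ↥(cmBorelTriple L 3 v).M) : ↥(unitaryGroupOfForm (conjLocal L (IsCMField.complexConj L) v) (cmLocalForm L 3 v)))
        (Kn : Set ↥(unitaryGroupOfForm (conjLocal L (IsCMField.complexConj L) v) (cmLocalForm L 3 v))) Kn ⊆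
      {γ : ↥(unitaryGroupOfForm (conjLocal L (IsCMField.complexConj L) v) (cmLocalForm L 3 v)) |
        1 < Valued.v ((Pi.evalRingHom (fun w' : PlacesOver L v => w'.1.adicCompletion L) w) (((γ : GL (Fin 3) (LocalRing L v)) : Matrix (Fin 3) (Fin 3) (LocalRing L v)).trace))} :=
  fun _ hx => one_lt_v_trace_of_mem_doubleCoset_torusChart L v hns w Kn hr hK m hm hx

/-- **(H2g) for NON-UNIT SHELLS**: `m₀ ∉ M_c`, `m ∈ m₀ • M_c`, `Kn` of deep level at `w` ⇒ `Kn · ι m · Kn ⊆ Ω°`. [cite: Rogawski1990, §12.7 L. 12.7.1 (proof) p. 191] -/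
theorem doubleCoset_torusChart_subset_setOf_one_lt_v_trace_of_mem_smul_torusCompactPart (hns : ∀ w : PlacesOver L v, IsCMField.complexConj L • w.1 = w.1) (w : PlacesOver L v)
    (Kn : Subgroup ↥(unitaryGroupOfForm (conjLocal L (IsCMField.complexConj L) v) (cmLocalForm L 3 v))) {r : WithZero (Multiplicative ℤ)} (hr : r < 1)
    (hK : ∀ k : ↥(unitaryGroupOfForm (conjLocal L (IsCMField.complexConj L) v) (cmLocalForm L 3 v)), k ∈ Kn → ∀ i j : Fin 3,
      Valued.v ((Pi.evalRingHom (fun w' : PlacesOver L v => w'.1.adicCompletion L) w)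
        ((k : GL (Fin 3) (LocalRing L v)).val i j - (1 : Matrix (Fin 3) (Fin 3) (LocalRing L v)) i j)) ≤ r)
    {m₀ m : (LocalRing L v)ˣ × ↥(normOneUnits (conjLocal L (IsCMField.complexConj L) v))}
    (hm₀ : m₀ ∉ ((Submonoid.pi Set.univ (fun w : PlacesOver L v => (w.1.adicCompletionIntegers L).toSubring.toSubmonoid)).units.prod (⊤ : Subgroup ↥(normOneUnits (conjLocal L (IsCMField.complexConj L) v)))))
    (hm : m ∈ m₀ • ((((Submonoid.pi Set.univ (fun w : PlacesOver L v => (w.1.adicCompletionIntegers L).toSubring.toSubmonoid)).units.prod (⊤ : Subgroup ↥(normOneUnits (conjLocal L (IsCMField.complexConj L) v)))) :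
      Subgroup ((LocalRing L v)ˣ × ↥(normOneUnits (conjLocal L (IsCMField.complexConj L) v)))) : Set ((LocalRing L v)ˣ × ↥(normOneUnits (conjLocal L (IsCMField.complexConj L) v))))) :
    DoubleCoset.doubleCoset ((torusChart L v m : ↥(cmBorelTriple L 3 v).M) : ↥(unitaryGroupOfForm (conjLocal L (IsCMField.complexConj L) v) (cmLocalForm L 3 v)))
        (Kn : Set ↥(unitaryGroupOfForm (conjLocal L (IsCMField.complexConj L) v) (cmLocalForm L 3 v))) Kn ⊆
      {γ : ↥(unitaryGroupOfForm (conjLocal L (IsCMField.complexConj L) v) (cmLocalForm L 3 v)) |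
        1 < Valued.v ((Pi.evalRingHom (fun w' : PlacesOver L v => w'.1.adicCompletion L) w) (((γ : GL (Fin 3) (LocalRing L v)) : Matrix (Fin 3) (Fin 3) (LocalRing L v)).trace))} :=
  doubleCoset_torusChart_subset_setOf_one_lt_v_trace L v hns w Kn hr hK m (v_fst_apply_ne_one_of_mem_smul_torusCompactPart L v hns w hm₀ hm)

end Summit.HodgeConjecture.HodgeConjecture.Cruxes.H413.F0P3cStCharTSHyperbolicSet

end
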